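import Literature.MeasureTheory.Group.LocalFieldLinearJacobian
import Literature.NumberTheory.Automorphic.TateLocalZetaShells
import Literature.NumberTheory.GaloisRepresentations.LocalFieldFiniteExtension
import HarnessLib

/-!
# The normalised absolute value along a finite embedding of local fields: `‖ι x‖_K = ‖x‖_{F′}^{[K : ι F′]}`

Topic `Literature/NumberTheory/LocalFields`; namespace `Literature.NumberTheory.LocalFields`.  THEOREMS ONLY (no definition ∕
instance ∕ notation ∕ named fact ∕ `sorry`).  Cell `pub/hodgecm-mathlib`, crux H413 = `stmt-HodgeConjecture-24833` (lane
`--supports`, count-neutral): brick **(NB) «QUADRATIC EMBEDDING NORM BRIDGE»** of the ROAD «HC-D» (holder F0P2-p01 (g23)), seat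
LH10-p01 (g7), 2026-09-02.  Consumers: GLOBAL §3 (F0P3a-p07, hypothesis `hιn`), D3b∕c docking, D5(i) FILE C, D5(iii).
HONEST LABEL: HC_CM is proved only modulo the 7 printed citations (2 remaining: hLiu418 = `stmt-HodgeConjecture-24832`, h413 =
`stmt-HodgeConjecture-24833`) until rung 0 closes; this file closes no organ.

## The statements

`K`, `F′` non-archimedean local fields (Mathlib `IsNonarchimedeanLocalField`; `normAbs` = the tree's normalised absolute value
`‖·‖ = q^{−v(·)}`, i.e. the Haar modulus), `ι : F′ →+* K` a CONTINUOUS ring homomorphism.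
* `normAbs_map_eq_pow_of_basis`: if `K` is free of rank `n` over `ι F′` on an explicit basis `b : Fin n → K`
  (every `y` is `∑ ι(cᵢ) bᵢ`, uniquely), then **`normAbs K (ι x) = normAbs F′ x ^ n`** — Weil's
  `mod_K(ι x) = mod_{F′}(x)^{[K : F′]}`.
* `normAbs_map_eq_sq_of_involution`: the quadratic case in the letters of the unitary-group files — an involution `σ` of `K`
  with fixed field `ι F′`, a skew unit `λ` (`σ λ = −λ`), `2` invertible ⇒ **`normAbs K (ι x) = normAbs F′ x ^ 2`** (basis `(1, λ)`).
No continuity of `σ`, no closedness of `ι` is needed.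

## The proof (Haar moduli; no ramification theory)

Inside the proof `K` is made an `F′`-algebra through `ι`; the basis gives a linear isomorphism `Φ : F′ⁿ ≃ K`, which is
BI-CONTINUOUS because `K` is a finite-dimensional Hausdorff topological vector space over the complete valued field `F′`
(Mathlib `LinearEquiv.toContinuousLinearEquiv`, with the tree's `IsNonarchimedeanLocalField.nontriviallyNormedField F′`, whose
topology is the given one).  Multiplication by `ι x` on `K` is `Φ`-conjugate to the diagonal dilation `x • id` of `F′ⁿ`, so their
Haar characters agree (★ `LocalFieldLinearJacobian.addEquivAddHaarChar_eq_of_semiconj`); the latter is `∏ᵢ mod_{F′}(x) =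
‖x‖_{F′}^n` (★ `addEquivAddHaarChar_eq_prod_of_apply_eq_mul`), the former is `‖ι x‖_K` (★ `addHaar_smul_set`, Tate's Lemma 2.2.5).

## References
* [WeilBNT1967] A. Weil, *Basic Number Theory* (1967), Ch. I §2, Cor. 3 of Thm. 3 (`mod_V(ι x) = mod_K(x)^{dim V}`) and Ch. I §4.
* [Tate1950] J. Tate, *Fourier analysis in number fields…* (1950), §2.2 Lemma 2.2.5 (`μ(a S) = ‖a‖ μ(S)`).
-/

set_option autoImplicit false

noncomputable section

open MeasureTheory MeasureTheory.Measure Set Filter Topology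
open scoped ENNReal NNReal Pointwise
open Literature.NumberTheory.GaloisRepresentations.IsNonarchimedeanLocalField
open Literature.NumberTheory.Automorphic

namespace Literature.NumberTheory.LocalFields

section NormBridge

variable {K F' : Type*} [Field K] [ValuativeRel K] [TopologicalSpace K] [IsNonarchimedeanLocalField K]
  [Field F'] [ValuativeRel F'] [TopologicalSpace F'] [IsNonarchimedeanLocalField F']

/-- **`distribHaarChar F a = ‖a‖_F`** for `a ≠ 0` in a non-archimedean local field (★ `addHaar_smul_set` on `𝒪 = 𝔭⁰`; Mathlib
`distribHaarChar_eq_of_measure_smul_eq_mul`). [cite: Tate1950, §2.2 Lemma 2.2.5] -/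
private theorem distribHaarChar_mk0 {F : Type*} [Field F] [ValuativeRel F] [TopologicalSpace F] [IsNonarchimedeanLocalField F]
    [MeasurableSpace F] [BorelSpace F] {a : F} (ha0 : a ≠ 0) : distribHaarChar F (Units.mk0 a ha0) = normAbs F a := by
  haveI := regular_of_isAddHaarMeasure (addHaar : Measure F)
  refine distribHaarChar_eq_of_measure_smul_eq_mul (μ := (addHaar : Measure F)) (s := primePowBall F 0)
    (addHaar_primePowBall_pos addHaar 0).ne' (measure_primePowBall_lt_top addHaar 0).ne ?_
  change addHaar (a • primePowBall F 0) = _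
  exact addHaar_smul_set addHaar ha0 _

/-- **The Haar character of `y ↦ a y` on a local field is `‖a‖`** (`a ≠ 0`): evaluate on `𝒪`. [cite: Tate1950, §2.2 Lemma 2.2.5] -/
private theorem addEquivAddHaarChar_eq_normAbs [MeasurableSpace K] [BorelSpace K] (φ : K ≃ₜ+ K) {a : K} (ha0 : a ≠ 0)
    (hφ : ∀ y, φ y = a * y) : addEquivAddHaarChar φ = normAbs K a := by
  haveI := regular_of_isAddHaarMeasure (addHaar : Measure K)
  have h1 := Literature.MeasureTheory.Group.measure_image_eq_addEquivAddHaarChar_mul (addHaar : Measure K) φ (primePowBall K 0)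
  have himg : φ '' primePowBall K 0 = a • primePowBall K 0 := by
    rw [← image_smul]
    exact image_congr fun y _ => hφ y
  rw [himg, addHaar_smul_set addHaar ha0] at h1
  exact ENNReal.coe_inj.1 ((ENNReal.mul_left_inj (addHaar_primePowBall_pos (addHaar : Measure K) 0).ne'
    (measure_primePowBall_lt_top (addHaar : Measure K) 0).ne).1 h1).symm

/-- **`‖ι x‖_K = ‖x‖_{F′}^n` for a free extension of rank `n`.**  `K`, `F′` non-archimedean local fields, `ι : F′ →+* K`
continuous, `b : Fin n → K` a basis of `K` over `ι F′` in elementary terms (`hspan`: every `y` is `∑ᵢ ι(cᵢ) bᵢ`; `hind`: uniquely).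
Then the normalised absolute values satisfy `normAbs K (ι x) = normAbs F′ x ^ n` — Weil's `mod_K ∘ ι = mod_{F′}^{[K:F′]}`,
proved by comparing Haar characters (module docstring).  [cite: WeilBNT1967, Ch. I §2 Cor. 3 of Thm. 3] -/
theorem normAbs_map_eq_pow_of_basis (ι : F' →+* K) (hι : Continuous ι) {n : ℕ} (b : Fin n → K)
    (hspan : ∀ y : K, ∃ c : Fin n → F', y = ∑ i, ι (c i) * b i)
    (hind : ∀ c : Fin n → F', ∑ i, ι (c i) * b i = 0 → c = 0) (x : F') :
    normAbs K (ι x) = normAbs F' x ^ n := by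
  rcases Nat.eq_zero_or_pos n with hn | hn
  · subst hn
    exfalso
    obtain ⟨c, hc⟩ := hspan 1
    simp at hc
  by_cases hx : x = 0
  · subst hx
    rw [map_zero, map_zero, map_zero, zero_pow hn.ne']
  have hιx : ι x ≠ 0 := (map_ne_zero ι).2 hx
  borelize K
  borelize F'
  -- `K` as a finite-dimensional topological `F′`-vector space
  letI := nontriviallyNormedField F'
  haveI : CompleteSpace F' := completeSpace_nontriviallyNormedField F'
  haveI := secondCountableTopology_localField F'
  letI : Algebra F' K := ι.toAlgebra
  have hsmul : ∀ (a : F') (y : K), a • y = ι a * y := fun a y => Algebra.smul_def a y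
  haveI : ContinuousSMul F' K := ⟨by
    have : (fun p : F' × K => p.1 • p.2) = fun p => ι p.1 * p.2 := funext fun p => hsmul p.1 p.2
    rw [this]
    exact (hι.comp continuous_fst).mul continuous_snd⟩
  haveI : T2Space K := (isLocalField K).toT2Space
  let L : (Fin n → F') →ₗ[F'] K := Fintype.linearCombination F' b
  have hL : ∀ c, L c = ∑ i, ι (c i) * b i := fun c => by
    simp only [L, Fintype.linearCombination_apply, hsmul]
  have hbij : Function.Bijective L := by
    constructor
    · intro c₁ c₂ h
      have h' : L (c₁ - c₂) = 0 := by rw [map_sub, h, sub_self]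
      rw [hL] at h'
      simpa [sub_eq_zero] using hind _ h'
    · intro y
      obtain ⟨c, hc⟩ := hspan y
      exact ⟨c, by rw [hL, hc]⟩
  haveI : FiniteDimensional F' K := Module.Finite.of_surjective L hbij.2
  let Φ : (Fin n → F') ≃L[F'] K := (LinearEquiv.ofBijective L hbij).toContinuousLinearEquiv
  have hΦ : ∀ c, Φ c = L c := fun _ => rfl
  -- the diagonal dilation `c ↦ x • c` of `F′ⁿ`
  let Dl : (Fin n → F') ≃ₗ[F'] (Fin n → F') := LinearEquiv.smulOfUnit (Units.mk0 x hx)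
  let D : (Fin n → F') ≃L[F'] (Fin n → F') :=
    ContinuousLinearEquiv.mk Dl Dl.toLinearMap.continuous_on_pi Dl.symm.toLinearMap.continuous_on_pi
  have hD : ∀ c i, D c i = x * c i := fun c i => by
    change (Units.mk0 x hx • c) i = x * c i
    rw [Units.smul_mk0, Pi.smul_apply, smul_eq_mul]
  have hDs : ∀ c, D c = x • c := fun c => funext fun i => by rw [hD, Pi.smul_apply, smul_eq_mul]
  -- multiplication by `ι x` is `Φ`-conjugate to `D`
  let e : K ≃ₜ+ (Fin n → F') := Φ.symm.toContinuousAddEquiv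
  let ψ : (Fin n → F') ≃ₜ+ (Fin n → F') := D.toContinuousAddEquiv
  let φ : K ≃ₜ+ K := (e.trans ψ).trans e.symm
  have hφ : ∀ y, φ y = ι x * y := fun y => by
    change Φ (D (Φ.symm y)) = ι x * y
    rw [hDs, map_smul, ContinuousLinearEquiv.apply_symm_apply, hsmul]
  have hsemi : ∀ y, e (φ y) = ψ (e y) := fun y => by
    change Φ.symm (Φ (D (Φ.symm y))) = D (Φ.symm y)
    rw [ContinuousLinearEquiv.symm_apply_apply]
  have h1 := Literature.MeasureTheory.Group.addEquivAddHaarChar_eq_of_semiconj e φ ψ hsemi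
  have h2 := Literature.MeasureTheory.Group.addEquivAddHaarChar_eq_prod_of_apply_eq_mul D (fun _ => Units.mk0 x hx)
    (fun c i => by rw [Units.val_mk0]; exact hD c i)
  rw [← addEquivAddHaarChar_eq_normAbs φ hιx hφ, h1]
  change addEquivAddHaarChar D.toContinuousAddEquiv = _
  rw [h2, Finset.prod_const, Finset.card_univ, Fintype.card_fin, distribHaarChar_mk0]

/-- **`‖ι x‖_K = ‖x‖_{F′}²` for a quadratic embedding given by an involution.**  `ι : F′ →+* K` continuous, `σ` an involutive
ring endomorphism of `K` with FIXED FIELD `ι F′` (`hιr`), `λ ∈ Kˣ` skew (`σ λ = −λ`), `2` invertible in `K` (the frame of the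
unitary-group files: then `(1, λ)` is a basis of `K` over `ι F′`, `y = ½(y + σy) + λ · ½λ⁻¹(y − σy)`).  Hence
`normAbs K (ι x) = normAbs F′ x ^ 2`.  No continuity of `σ` is used.  [cite: WeilBNT1967, Ch. I §2 Cor. 3 of Thm. 3] -/
theorem normAbs_map_eq_sq_of_involution (ι : F' →+* K) (hι : Continuous ι) (σ : K →+* K) (hσ : ∀ y, σ (σ y) = y)
    (hιr : ∀ y, σ y = y ↔ y ∈ Set.range ι) [Invertible (2 : K)] (lam : Kˣ) (hlam : σ lam = -lam) (x : F') :
    normAbs K (ι x) = normAbs F' x ^ 2 := by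
  have h2 : (2 : K) ≠ 0 := Invertible.ne_zero 2
  have hσ2 : σ (2⁻¹ : K) = 2⁻¹ := by rw [map_inv₀, map_ofNat]
  have hfix : ∀ a : F', σ (ι a) = ι a := fun a => (hιr _).2 ⟨a, rfl⟩
  have hlam' : σ ((lam : K)⁻¹) = -(lam : K)⁻¹ := by rw [map_inv₀, hlam, inv_neg]
  refine normAbs_map_eq_pow_of_basis ι hι ![1, (lam : K)] (fun y => ?_) (fun c hc => ?_) x
  · -- spanning: the `σ`-fixed and `σ`-skew parts
    obtain ⟨a₁, ha₁⟩ := (hιr (2⁻¹ * (y + σ y))).1 (by rw [map_mul, hσ2, map_add, hσ, add_comm])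
    obtain ⟨a₂, ha₂⟩ := (hιr (2⁻¹ * ((lam : K)⁻¹ * (y - σ y)))).1 (by
      rw [map_mul, hσ2, map_mul, hlam', map_sub, hσ]; ring)
    refine ⟨![a₁, a₂], ?_⟩
    simp only [Fin.sum_univ_two, Matrix.cons_val_zero, Matrix.cons_val_one, ha₁, ha₂]
    field_simp
    ring
  · -- independence: apply `σ`
    simp only [Fin.sum_univ_two, Matrix.cons_val_zero, Matrix.cons_val_one, mul_one] at hc
    have hc' : ι (c 0) - ι (c 1) * lam = 0 := by
      have := congrArg σ hc
      rw [map_add, map_mul, hfix, hfix, hlam, map_zero, mul_neg, ← sub_eq_add_neg] at this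
      exact this
    have h0 : ι (c 0) = 0 := by
      have hsum : 2 * ι (c 0) = 0 := by linear_combination hc + hc'
      exact (mul_eq_zero.1 hsum).resolve_left h2
    have h1 : ι (c 1) = 0 := by
      rw [h0, zero_add] at hc
      exact (mul_eq_zero.1 hc).resolve_right lam.ne_zero
    funext i
    fin_cases i
    · exact (map_eq_zero ι).1 h0
    · exact (map_eq_zero ι).1 h1

end NormBridge

end Literature.NumberTheory.LocalFields

end
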